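import Summits.QuantumFields.YangMills.Theorems.BalabanUVNodesN15TorusReflectionsDeltaA
import Literature.MathematicalPhysics.QuantumFieldTheory.Balaban1983to89.B5Adjoint130
import Literature.MathematicalPhysics.QuantumFieldTheory.Balaban1983to89.B5Adjoint176
import HarnessLib

/-!
# Route «BalabanUVNodes» (K3⁷), node N15 = NE2, -a lane, PROGRAMME P file P-Ia: THE PERIODISATION HOMOMORPHISM `π : T_{N} → T_{N′}` (`N′ ∣ N`) OF THE b05 TORI,
# ITS FIBRES, THE PULL-BACK MATRICES ON SCALARS AND 1-FORMS, AND THE DESCENT OF THE ONE-TORUS LETTERS `Δ, ∂, ∂*, Σ∇*∇, Π₀, Δ⁻¹`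

Cell `pub-ymgap`, seat `pub-ymgap-dag-n15-a` (KNIT-BY-NAME, g20; D-0062; chair R424 venue; `bears_on: R4∕N15`); `--kind proof --supports stmt-QuantumFields-20544 --as helper`.
Sequel of PROGRAMME N (N-Ia∕N-Ib `…N15TorusReflections(DeltaA)`, N-Ic `…N15TorusTranslations`, N-IIIa `…N15NeumannCubePropagator` …).

WHY.  Programme N built the Neumann-by-images cube propagator `G(□) = Sym ∘ G ∘ χ°` of [Balaban1984PropagatorsII] (2.37) on the DOUBLED torus `Tor (fine n M′)`, `M′_ν = 2S`
(the cube and its mirror tile the torus; per-cube locality `M_h ∘ Δ_a ∘ G(□) = M_h` is EXACT there).  The torus family of record of this lineage is `Tor (fine n M)`, `M_ν = 2L^{m_T}`: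
the background-live dressing of the gluing needs cubes of FIXED side `S` on tori of ANY volume ([Balaban1985BackgroundPropagators] (3.35): regularity on cubes of size `M`).
PRINT identifies the cube world with a small torus: [Balaban1984PropagatorsII] p. 238–239 «We take the cube □̃³ and identify it with a torus, denoted by `T_□`, imposing
periodicity conditions. On this torus we define operators `R, Δ_a` …».  THE DEVICE of programme P: for `N′ ∣ N` coordinatewise, the reduction homomorphism
`π : Tor N → Tor N′` (`ZMod.castHom`) is compatible with every b05 letter — they DESCEND: `X_{N} ∘ π^* = π^* ∘ X_{N′}` for the pull-back `π^*` — because every letter is a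
translation-invariant local stencil, a block average (blocks go to blocks), or an (pseudo-)inverse of such.  With the descent of `Δ_a` and `G = Δ_a⁻¹` (sequel P-Ib) the doubled-torus
cube propagator LIFTS to `Tor (fine n M)` (`2S ∣ M_ν`) as `π^* ∘ G(□) ∘ π_! ∘ M_{χ°}` with EXACT per-cube locality and with every gluing row of N-IIIb…N-IIj read through `π` (sequel P-II).

WHAT (this file, one pair of tori `N′ ∣ N`).  §1 `torRed hN : Tor N → Tor N′` (coordinatewise `ZMod.castHom`), additive, `π(e_μ) = e_μ`, `π(t·e_μ) = t·e_μ`, surjective.  §2 FIBRES: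
all fibres of `π` have the same cardinality `fibCard hN` (`card_fiber_torRed`), `fibCard · |T_{N′}| = |T_N|`, and ★ `sum_comp_torRed : Σ_x g(πx) = fibCard • Σ_y g(y)`.  §3 the pull-back
matrices `pullS hN` (scalars: `(π^*f)(x) = f(πx)`) and `pullV hN` (1-forms, the bond direction passive), real.  §4 DESCENT of the one-torus letters (rectangular intertwiners
`X_N · π^* = π^* · X_{N′}`): `LapS` (1.21), ★ `GradOp` and ★ `GradOpᴴ` (the divergence — proved pointwise, `π^*` is not unitary), `LapV`, ★ `Pker` (the projection onto constants:
fibre counting), ★★ `LapSinv` (the pseudo-inverse, by the algebra `Δ⁻¹Δ = 1 − Π₀ = ΔΔ⁻¹`, `Π₀Δ⁻¹ = 0 = Δ⁻¹Π₀` on BOTH tori — `rect_comm_LapSinv`), and the generic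
★ `rect_inv_comm` (`A·P = P·A′`, `A, A′` invertible ⟹ `A⁻¹·P = P·A′⁻¹`).
HONEST FRAMING.  Finite-dimensional lattice algebra (a group homomorphism of finite tori and rectangular 0∕1 matrices); no estimate; `U ≡ 1` torus MODEL of [B5] §1;
nothing of [B6] (2.38)–(2.40)∕[B9] asserted; N15 NOT discharged (object-bound; NE2⁺ NOT PRINTED); counts UNMOVED (typed 28∕28 · discharged 5∕27); finite tori at fixed
lattice spacing — NOT continuum ∕ ℝ⁴ ∕ OS ∕ mass gap ∕ Clay.  Plumbing defs are DATA (`torRed`, `fibCard`, `pullS`, `pullV`); every theorem is [folklore] lattice algebra about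
printed objects.
-/

noncomputable section

open scoped BigOperators Matrix ComplexConjugate
open Finset

namespace Summit.QuantumFields.YangMills.BalabanUVNodes.N15.TwoGrid

open Literature.MathematicalPhysics.QuantumFieldTheory.Balaban1983to89
open Literature.MathematicalPhysics.QuantumFieldTheory.Balaban1983to89.B5Prop11Plancherel (Tor fine unitVec shiftM fdiff)
open Literature.MathematicalPhysics.QuantumFieldTheory.Balaban1983to89.B5Block118 (tstep up upHom iota bpt lineSum QsOp QvOp QsOp_mulVec QvOp_mulVec tstep_succ)
open Literature.MathematicalPhysics.QuantumFieldTheory.Balaban1983to89.B5Action121 (shiftS sdiff sdiff_mulVec GradOp GradOp_mulVec LapS LapS_mulVec LapV divS divS_apply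
  GradOp_conjTranspose_mulVec)
open Literature.MathematicalPhysics.QuantumFieldTheory.Balaban1983to89.B5Prop11Lower (Lap)
open Literature.MathematicalPhysics.QuantumFieldTheory.Balaban1983to89.B5LaplaceInverse (LapSinv Pker LapS_mul_LapSinv LapSinv_mul_LapS LapSinv_mul_Pker
  Pker_mul_LapSinv Pker_const Pker_orth)
open Literature.MathematicalPhysics.QuantumFieldTheory.Balaban1983to89.B5LaplaceSpectral (LapS_const)
open Literature.MathematicalPhysics.QuantumFieldTheory.Balaban1983to89.B5RealFields (IsReal reM)

variable {d : ℕ}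

/-! ## §1 The reduction homomorphism `π : T_N → T_{N′}` for `N′ ∣ N` -/

section Reduction

variable {N N' : Fin d → ℕ} (hN : ∀ μ, N' μ ∣ N μ)

/-- **THE PERIODISATION HOMOMORPHISM** `π : Π_μ ℤ∕N_μ → Π_μ ℤ∕N′_μ` (`N′_μ ∣ N_μ`): coordinatewise reduction — the torus `T_N` read modulo the sub-lattice `N′ℤ^d`; print's
«identify [the cube □̃³] with a torus, denoted by `T_□`, imposing periodicity conditions». [cite: Balaban1984PropagatorsII, p.238 («we take the cube □̃³ and identify it with a torus»)] -/
def torRed (x : Tor N) : Tor N' := fun μ => ZMod.castHom (hN μ) (ZMod (N' μ)) (x μ)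

/-- `(πx)_μ = castHom (x_μ)`. [folklore] -/
theorem torRed_apply (x : Tor N) (μ : Fin d) : torRed hN x μ = ZMod.castHom (hN μ) (ZMod (N' μ)) (x μ) := rfl

/-- `π` is additive. [folklore] -/
theorem torRed_add (x y : Tor N) : torRed hN (x + y) = torRed hN x + torRed hN y := by
  funext μ; exact map_add (ZMod.castHom (hN μ) (ZMod (N' μ))) (x μ) (y μ)

/-- `π(x − y) = πx − πy`. [folklore] -/
theorem torRed_sub (x y : Tor N) : torRed hN (x - y) = torRed hN x - torRed hN y := by
  funext μ; exact map_sub (ZMod.castHom (hN μ) (ZMod (N' μ))) (x μ) (y μ)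

/-- `π(−x) = −πx`. [folklore] -/
theorem torRed_neg (x : Tor N) : torRed hN (-x) = -torRed hN x := by
  funext μ; exact map_neg (ZMod.castHom (hN μ) (ZMod (N' μ))) (x μ)

/-- `π 0 = 0`. [folklore] -/
theorem torRed_zero : torRed hN (0 : Tor N) = 0 := by
  funext μ; exact map_zero (ZMod.castHom (hN μ) (ZMod (N' μ)))

/-- `π` maps a coordinatewise integer vector to the same integer vector. [folklore] -/
theorem torRed_intCast (z : Fin d → ℤ) : torRed hN (fun μ => (z μ : ZMod (N μ))) = fun μ => (z μ : ZMod (N' μ)) := by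
  funext μ; exact map_intCast (ZMod.castHom (hN μ) (ZMod (N' μ))) (z μ)

/-- `π(e_μ) = e_μ`. [folklore] -/
theorem torRed_unitVec (μ : Fin d) : torRed hN (unitVec N μ) = unitVec N' μ := by
  funext ν
  by_cases h : ν = μ
  · subst h; rw [torRed_apply, unitVec, unitVec, Pi.single_eq_same, Pi.single_eq_same, map_one]
  · rw [torRed_apply, unitVec, unitVec, Pi.single_eq_of_ne h, Pi.single_eq_of_ne h, map_zero]

/-- `π(t·e_μ) = t·e_μ`. [folklore] -/
theorem torRed_tstep (μ : Fin d) (t : ℕ) : torRed hN (tstep N μ t) = tstep N' μ t := by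
  funext ν
  by_cases h : ν = μ
  · subst h; simp only [torRed_apply, tstep, if_true, map_natCast]
  · simp only [torRed_apply, tstep, if_neg h, map_zero]

/-- `π(x + e_μ) = πx + e_μ`. [folklore] -/
theorem torRed_add_unitVec (x : Tor N) (μ : Fin d) : torRed hN (x + unitVec N μ) = torRed hN x + unitVec N' μ := by
  rw [torRed_add, torRed_unitVec]

/-- `π(x − e_μ) = πx − e_μ`. [folklore] -/
theorem torRed_sub_unitVec (x : Tor N) (μ : Fin d) : torRed hN (x - unitVec N μ) = torRed hN x - unitVec N' μ := by
  rw [torRed_sub, torRed_unitVec]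

/-- `π(x + t·e_μ) = πx + t·e_μ`. [folklore] -/
theorem torRed_add_tstep (x : Tor N) (μ : Fin d) (t : ℕ) : torRed hN (x + tstep N μ t) = torRed hN x + tstep N' μ t := by
  rw [torRed_add, torRed_tstep]

/-- `π(x − t·e_μ) = πx − t·e_μ`. [folklore] -/
theorem torRed_sub_tstep (x : Tor N) (μ : Fin d) (t : ℕ) : torRed hN (x - tstep N μ t) = torRed hN x - tstep N' μ t := by
  rw [torRed_sub, torRed_tstep]

variable [∀ μ, NeZero (N' μ)]

/-- a section of `π`: the integer lift of the coordinates. [folklore] -/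
theorem torRed_intCast_val (y : Tor N') : torRed hN (fun μ => (((y μ).val : ℤ) : ZMod (N μ))) = y := by
  rw [torRed_intCast]; funext μ; rw [Int.cast_natCast, ZMod.natCast_zmod_val]

/-- `π` is surjective. [folklore] -/
theorem torRed_surjective : Function.Surjective (torRed hN) := fun y => ⟨_, torRed_intCast_val hN y⟩

end Reduction

/-! ## §2 Fibres of `π`: equal cardinality, fibre sums -/

section Fibres

variable {N N' : Fin d → ℕ} [∀ μ, NeZero (N μ)] [∀ μ, NeZero (N' μ)] (hN : ∀ μ, N' μ ∣ N μ)

/-- the common cardinality of the fibres of `π` (the index of the sub-lattice `N′ℤ^d ∕ Nℤ^d`), defined as the cardinality of the kernel. [folklore] -/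
def fibCard : ℕ := Fintype.card {x : Tor N // torRed hN x = 0}

/-- every fibre of `π` is a translate of the kernel: `card π⁻¹(y) = fibCard`. [folklore] -/
theorem card_fiber_torRed (y : Tor N') : Fintype.card {x : Tor N // torRed hN x = y} = fibCard hN := by
  obtain ⟨x₀, hx₀⟩ := torRed_surjective hN y
  refine Fintype.card_congr (Equiv.subtypeEquiv (Equiv.subRight x₀) fun x => ?_)
  rw [Equiv.subRight_apply, torRed_sub, hx₀, sub_eq_zero]

/-- `fibCard · |T_{N′}| = |T_N|`. [folklore] -/
theorem fibCard_mul_card : fibCard hN * Fintype.card (Tor N') = Fintype.card (Tor N) := by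
  rw [← Fintype.card_congr (Equiv.sigmaFiberEquiv (torRed hN)), Fintype.card_sigma]
  simp only [card_fiber_torRed, Finset.sum_const, Finset.card_univ, smul_eq_mul]
  ring

omit [∀ μ, NeZero (N' μ)] in
/-- `fibCard ≠ 0`. [folklore] -/
theorem fibCard_pos : 0 < fibCard hN := Fintype.card_pos_iff.mpr ⟨⟨0, torRed_zero hN⟩⟩

/-- ★ **FIBRE SUMS**: `Σ_{x ∈ T_N} g(πx) = fibCard • Σ_{y ∈ T_{N′}} g(y)`. [folklore] -/
theorem sum_comp_torRed {α : Type} [AddCommMonoid α] (g : Tor N' → α) : ∑ x : Tor N, g (torRed hN x) = fibCard hN • ∑ y : Tor N', g y := by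
  rw [← Fintype.sum_equiv (Equiv.sigmaFiberEquiv (torRed hN)) (fun s => g (torRed hN s.2.1)) (fun x => g (torRed hN x)) (fun _ => rfl), Fintype.sum_sigma,
    Finset.smul_sum]
  refine Finset.sum_congr rfl fun y _ => ?_
  have h : ∀ b : {x : Tor N // torRed hN x = y}, g (torRed hN b.1) = g y := fun b => by rw [b.2]
  simp only [h, Finset.sum_const, Finset.card_univ, card_fiber_torRed]

/-- the complex-valued fibre-sum rule. [folklore] -/
theorem sum_comp_torRed_complex (g : Tor N' → ℂ) : ∑ x : Tor N, g (torRed hN x) = (fibCard hN : ℂ) * ∑ y : Tor N', g y := by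
  rw [sum_comp_torRed, nsmul_eq_mul]

/-- the ratio of torus cardinalities: `|T_N|⁻¹ · fibCard = |T_{N′}|⁻¹` (in `ℂ`). [folklore] -/
theorem fibCard_div_card : (fibCard hN : ℂ) / (Fintype.card (Tor N) : ℂ) = 1 / (Fintype.card (Tor N') : ℂ) := by
  have h1 : (Fintype.card (Tor N) : ℂ) ≠ 0 := by exact_mod_cast Fintype.card_ne_zero
  have h2 : (Fintype.card (Tor N') : ℂ) ≠ 0 := by exact_mod_cast Fintype.card_ne_zero
  rw [div_eq_div_iff h1 h2, one_mul, ← Nat.cast_mul, fibCard_mul_card]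

end Fibres

/-! ## §3 The pull-back matrices on scalars and on 1-forms -/

section Pull

variable {N N' : Fin d → ℕ} [∀ μ, NeZero (N μ)] [∀ μ, NeZero (N' μ)] (hN : ∀ μ, N' μ ∣ N μ)

/-- **THE PULL-BACK OF SCALAR LATTICE FUNCTIONS** along `π`: `(π^*f)(x) = f(πx)`, as a rectangular 0∕1 matrix `T_N ← T_{N′}`. [folklore] -/
def pullS : Matrix (Tor N) (Tor N') ℂ := fun x y => if y = torRed hN x then 1 else 0

/-- **THE PULL-BACK OF LATTICE 1-FORMS** along `π` (the bond `⟨x, x + e_μ⟩` of `T_N` reads the bond `⟨πx, πx + e_μ⟩` of `T_{N′}`; the direction is passive). [folklore] -/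
def pullV : Matrix (Tor N × Fin d) (Tor N' × Fin d) ℂ := fun i j => if j = (torRed hN i.1, i.2) then 1 else 0

omit [∀ μ, NeZero (N μ)] in
/-- `(π^*f)(x) = f(πx)`. [folklore] -/
theorem pullS_mulVec (f : Tor N' → ℂ) (x : Tor N) : (pullS hN *ᵥ f) x = f (torRed hN x) := by
  simp only [Matrix.mulVec, dotProduct, pullS, ite_mul, one_mul, zero_mul, Finset.sum_ite_eq', Finset.mem_univ, if_true]

omit [∀ μ, NeZero (N μ)] in
/-- `(π^*A)(x, μ) = A(πx, μ)`. [folklore] -/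
theorem pullV_mulVec (A : Tor N' × Fin d → ℂ) (x : Tor N) (μ : Fin d) : (pullV hN *ᵥ A) (x, μ) = A (torRed hN x, μ) := by
  simp only [Matrix.mulVec, dotProduct, pullV, ite_mul, one_mul, zero_mul, Finset.sum_ite_eq', Finset.mem_univ, if_true]

omit [∀ μ, NeZero (N μ)] [∀ μ, NeZero (N' μ)] in
/-- `π^*` is real. [folklore] -/
theorem isReal_pullS : IsReal (pullS hN) := fun x y => by unfold pullS; split_ifs <;> simp

omit [∀ μ, NeZero (N μ)] [∀ μ, NeZero (N' μ)] in
/-- `π^*` is real (1-forms). [folklore] -/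
theorem isReal_pullV : IsReal (pullV hN) := fun i j => by unfold pullV; split_ifs <;> simp

omit [∀ μ, NeZero (N' μ)] in
/-- `(π^*)ᴴ` is the FIBRE SUM `(π_!g)(y) = Σ_{πx = y} g(x)`. [folklore] -/
theorem pullS_conjTranspose_mulVec (g : Tor N → ℂ) (y : Tor N') : ((pullS hN)ᴴ *ᵥ g) y = ∑ x, if torRed hN x = y then g x else 0 := by
  simp only [Matrix.mulVec, dotProduct, Matrix.conjTranspose_apply, pullS]
  refine Finset.sum_congr rfl fun x _ => ?_
  by_cases h : torRed hN x = y
  · rw [if_pos h.symm, if_pos h, star_one, one_mul]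
  · rw [if_neg (fun h' => h h'.symm), if_neg h, star_zero, zero_mul]

omit [∀ μ, NeZero (N μ)] in
/-- the pull-back of a constant is the constant. [folklore] -/
theorem pullS_mulVec_const (a : ℂ) : pullS hN *ᵥ (fun _ : Tor N' => a) = fun _ : Tor N => a := by
  funext x; rw [pullS_mulVec]

/-- `Σ_x (π^*f)(x) = fibCard · Σ_y f(y)`. [folklore] -/
theorem sum_pullS_mulVec (f : Tor N' → ℂ) : ∑ x, (pullS hN *ᵥ f) x = (fibCard hN : ℂ) * ∑ y, f y := by
  simp only [pullS_mulVec]; exact sum_comp_torRed_complex hN f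

end Pull

/-! ## §4 Descent of the one-torus letters: `Δ`, `∂`, `∂*`, `Σ_ν∇_ν^*∇_ν`, `Π₀`, `Δ⁻¹` -/

section Scalar

variable {N N' : Fin d → ℕ} [∀ μ, NeZero (N μ)] [∀ μ, NeZero (N' μ)] (hN : ∀ μ, N' μ ∣ N μ) (c : ℂ)

/-- `Δ_N π^* = π^* Δ_{N′}` for the scalar Laplacian (a translation-invariant nearest-neighbour stencil). [cite: Balaban1984PropagatorsI, (1.21) p.21] -/
theorem LapS_mul_pullS : LapS N c * pullS hN = pullS hN * LapS N' c := by
  refine matrix_eq_of_mulVec_eq fun f => funext fun x => ?_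
  rw [← Matrix.mulVec_mulVec, ← Matrix.mulVec_mulVec, LapS_mulVec, pullS_mulVec hN (LapS N' c *ᵥ f) x, LapS_mulVec]
  refine Finset.sum_congr rfl fun ν _ => ?_
  rw [pullS_mulVec, pullS_mulVec, pullS_mulVec, torRed_add_unitVec, torRed_sub_unitVec]

/-- ★ `∂_N π^* = π^* ∂_{N′}` (pull-back of scalars to pull-back of 1-forms). [cite: Balaban1984PropagatorsI, (1.4) p.18] -/
theorem GradOp_mul_pullS : GradOp N c * pullS hN = pullV hN * GradOp N' c := by
  refine matrix_eq_of_mulVec_eq fun l => funext fun i => ?_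
  obtain ⟨x, μ⟩ := i
  rw [← Matrix.mulVec_mulVec, ← Matrix.mulVec_mulVec, GradOp_mulVec, sdiff_mulVec, pullS_mulVec, pullS_mulVec, pullV_mulVec, GradOp_mulVec, sdiff_mulVec,
    torRed_add_unitVec]

/-- ★ `∂*_N π^* = π^* ∂*_{N′}`: THE DIVERGENCE DESCENDS (proved pointwise from `(∂*A)(x) = Σ_μ c̄(A(x − e_μ, μ) − A(x, μ))`; `π^*` is not unitary, so this is NOT the adjoint of
`GradOp_mul_pullS`). [cite: Balaban1984PropagatorsI, (1.21) p.21] -/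
theorem GradOp_conjTranspose_mul_pullV : (GradOp N c)ᴴ * pullV hN = pullS hN * (GradOp N' c)ᴴ := by
  refine matrix_eq_of_mulVec_eq fun A => funext fun x => ?_
  rw [← Matrix.mulVec_mulVec, ← Matrix.mulVec_mulVec, GradOp_conjTranspose_mulVec, divS_apply, pullS_mulVec, GradOp_conjTranspose_mulVec, divS_apply]
  refine Finset.sum_congr rfl fun μ _ => ?_
  rw [pullV_mulVec, pullV_mulVec, torRed_sub_unitVec]

/-- `(Σ_ν∇_ν^*∇_ν)_N π^* = π^* (Σ_ν∇_ν^*∇_ν)_{N′}` for the vector Laplacian (componentwise stencil). [cite: Balaban1984PropagatorsI, (1.21) p.21, (1.90) p.33] -/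
theorem LapV_mul_pullV : LapV N c * pullV hN = pullV hN * LapV N' c := by
  refine matrix_eq_of_mulVec_eq fun u => funext fun i => ?_
  obtain ⟨x, μ⟩ := i
  rw [← Matrix.mulVec_mulVec, ← Matrix.mulVec_mulVec, LapV_mulVec_apply, pullV_mulVec hN (LapV N' c *ᵥ u) x μ, LapV_mulVec_apply]
  refine Finset.sum_congr rfl fun ν _ => ?_
  rw [pullV_mulVec, pullV_mulVec, pullV_mulVec, torRed_add_unitVec, torRed_sub_unitVec]

/-- `Π₀` maps a constant to itself. [folklore] -/
theorem Pker_mulVec_const (a : ℂ) : Pker N c *ᵥ (fun _ : Tor N => a) = fun _ => a := by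
  have h1 : (LapSinv N c * LapS N c) *ᵥ (fun _ : Tor N => a) = (1 - Pker N c) *ᵥ (fun _ : Tor N => a) := by rw [LapSinv_mul_LapS]
  rw [← Matrix.mulVec_mulVec, LapS_const, Matrix.mulVec_zero, Matrix.sub_mulVec, Matrix.one_mulVec] at h1
  exact (sub_eq_zero.mp h1.symm).symm

/-- ★ `Π₀^{N} π^* = π^* Π₀^{N′}` (`c ≠ 0`): THE PROJECTION ONTO CONSTANTS DESCENDS — a function of mean zero pulls back to a function of mean zero because all fibres of
`π` have the same cardinality. [folklore] -/
theorem Pker_mul_pullS (hc : c ≠ 0) : Pker N c * pullS hN = pullS hN * Pker N' c := by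
  refine matrix_eq_of_mulVec_eq fun f => ?_
  rw [← Matrix.mulVec_mulVec, ← Matrix.mulVec_mulVec]
  -- split `f = g + m` with `m` the constant `Π₀ f` and `g` of mean zero
  obtain ⟨m, hm⟩ : ∃ m : ℂ, Pker N' c *ᵥ f = fun _ => m := ⟨(Pker N' c *ᵥ f) 0, funext fun y => Pker_const N' hc f y⟩
  obtain ⟨g, hg⟩ : ∃ g : Tor N' → ℂ, g = fun y => f y - m := ⟨_, rfl⟩
  have hdec : f = g + fun _ => m := by rw [hg]; funext y; simp
  have hP0 : Pker N' c *ᵥ g = 0 := by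
    have : g = f - fun _ => m := by rw [hg]; rfl
    rw [this, Matrix.mulVec_sub, hm, Pker_mulVec_const, sub_self]
  -- `g` has mean zero on `T_{N′}`: `g = Δ(Δ⁻¹g)` since `Π₀ g = 0`
  have hsum : ∑ y, g y = 0 := by
    have h2 : (LapS N' c * LapSinv N' c) *ᵥ g = g := by rw [LapS_mul_LapSinv, Matrix.sub_mulVec, Matrix.one_mulVec, hP0, sub_zero]
    rw [← h2, ← Matrix.mulVec_mulVec]
    exact B5DivOrth.sum_LapS N' c _
  -- hence its pull-back has mean zero on `T_N` (equal fibres) and is killed by `Π₀^{N}`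
  have hsumN : ∑ x, (pullS hN *ᵥ g) x = 0 := by rw [sum_pullS_mulVec, hsum, mul_zero]
  have hPN : Pker N c *ᵥ (pullS hN *ᵥ g) = 0 := Pker_orth N hc _ hsumN
  rw [hdec, Matrix.mulVec_add, Matrix.mulVec_add, hPN, zero_add, pullS_mulVec_const, Pker_mulVec_const, Matrix.mulVec_add, hP0, zero_add,
    Pker_mulVec_const, pullS_mulVec_const]

/-- ★ **RECTANGULAR COMMUTATION WITH THE PSEUDO-INVERSE**: anything intertwining `Δ` and `Π₀` between the two tori intertwines `Δ⁻¹` — from the algebra `Δ⁻¹Δ = 1 − Π₀`,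
`ΔΔ⁻¹ = 1 − Π₀`, `Π₀Δ⁻¹ = 0 = Δ⁻¹Π₀` on both tori (N-Ib `comm_LapSinv_of_comm` made rectangular). [folklore] -/
theorem rect_comm_LapSinv {P : Matrix (Tor N) (Tor N') ℂ} (hL : LapS N c * P = P * LapS N' c) (hP : Pker N c * P = P * Pker N' c) :
    LapSinv N c * P = P * LapSinv N' c := by
  have h1 : LapSinv N c * LapS N c + Pker N c = 1 := by rw [LapSinv_mul_LapS]; abel
  have h1' : LapS N' c * LapSinv N' c + Pker N' c = 1 := by rw [LapS_mul_LapSinv]; abel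
  calc LapSinv N c * P = LapSinv N c * P * (LapS N' c * LapSinv N' c + Pker N' c) := by rw [h1', Matrix.mul_one]
    _ = LapSinv N c * (P * LapS N' c) * LapSinv N' c + LapSinv N c * (P * Pker N' c) := by simp only [Matrix.mul_add, Matrix.mul_assoc]
    _ = LapSinv N c * (LapS N c * P) * LapSinv N' c + LapSinv N c * (Pker N c * P) := by rw [hL, hP]
    _ = (LapSinv N c * LapS N c) * P * LapSinv N' c + (LapSinv N c * Pker N c) * P := by simp only [Matrix.mul_assoc]
    _ = P * LapSinv N' c - Pker N c * (P * LapSinv N' c) := by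
        rw [LapSinv_mul_LapS, LapSinv_mul_Pker, Matrix.zero_mul, add_zero, Matrix.sub_mul, Matrix.one_mul, Matrix.sub_mul, Matrix.mul_assoc]
    _ = P * LapSinv N' c - P * (Pker N' c * LapSinv N' c) := by rw [← Matrix.mul_assoc, hP, Matrix.mul_assoc]
    _ = P * LapSinv N' c := by rw [Pker_mul_LapSinv, Matrix.mul_zero, sub_zero]

/-- ★★ `Δ⁻¹_N π^* = π^* Δ⁻¹_{N′}`: the pseudo-inverse of the scalar Laplacian descends (`c ≠ 0`). [cite: Balaban1984PropagatorsI, Sect. C p.22] -/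
theorem LapSinv_mul_pullS (hc : c ≠ 0) : LapSinv N c * pullS hN = pullS hN * LapSinv N' c :=
  rect_comm_LapSinv c (LapS_mul_pullS hN c) (Pker_mul_pullS hN c hc)

/-- ★ **RECTANGULAR INVERSE INTERTWINING**: `A·P = P·A′` with `A, A′` invertible gives `A⁻¹·P = P·A′⁻¹`. [folklore] -/
theorem rect_inv_comm {m k : Type} [Fintype m] [Fintype k] [DecidableEq m] [DecidableEq k] {A : Matrix m m ℂ} {A' : Matrix k k ℂ} {P : Matrix m k ℂ}
    (hA : IsUnit A.det) (hA' : IsUnit A'.det) (h : A * P = P * A') : A⁻¹ * P = P * A'⁻¹ := by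
  calc A⁻¹ * P = A⁻¹ * P * (A' * A'⁻¹) := by rw [Matrix.mul_nonsing_inv _ hA', Matrix.mul_one]
    _ = A⁻¹ * (P * A') * A'⁻¹ := by simp only [Matrix.mul_assoc]
    _ = A⁻¹ * (A * P) * A'⁻¹ := by rw [h]
    _ = (A⁻¹ * A) * P * A'⁻¹ := by simp only [Matrix.mul_assoc]
    _ = P * A'⁻¹ := by rw [Matrix.nonsing_inv_mul _ hA, Matrix.one_mul]

end Scalar

end Summit.QuantumFields.YangMills.BalabanUVNodes.N15.TwoGrid

end
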